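import Summits.RiemannHypothesis.RiemannHypothesis.Theorems.WeilFormatCDeflatedFarEnvelope
import Summits.RiemannHypothesis.RiemannHypothesis.Theorems.WeilFormatCDeflatedFarEntryLimits
import Summits.RiemannHypothesis.RiemannHypothesis.Theorems.WeilFormatCDeflatedFarSectorOdd
import Summits.RiemannHypothesis.RiemannHypothesis.Theorems.WeilFormatCDeflatedFarSectorDecay
import Summits.RiemannHypothesis.RiemannHypothesis.Theorems.WeilFormatCKernelEnvelope
import Summits.RiemannHypothesis.RiemannHypothesis.Theorems.WeilFormatCCertificate
import HarnessLib

/-!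
# Format C, design C∞: the ODD-sector certificate with limit data — all analytic hypotheses discharged

Route context: Fourier–Galerkin / Schur-complement certificates of Weil positivity on a window ("format C";
cell memo `run/shared/lean/pub/rh-explicit/rh-explicit-weil-10/KERNEL-LEVER.md` §17–§19; supporting
stmt-RiemannHypothesis-0098; seat rh-explicit-weil-10).

Companion of `WeilFormatCDeflatedFarDoorEven`: `sum_range_mul_mul_nonneg_of_certificate_cinf` instantiated on the ODD
sector kernel `M⁻(k,l) = (G(k+1,l+1) − G(k+1,−(l+1)))/2`, `G = gramCoeff a`, with `r` ODD REAL PROFILES `1f_j`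
(`f_j ∈ C³`, odd, real-valued, `f_j(a) = 0`, `f_j′(−a) = f_j′(a)`), block `[0, B)` (modes `1 … B`, `B ≥ 1`) and the real
profile table `V(k,j) = 2 Im ĉ_{k+1}(1f_j)/√(2a)`.  The analytic hypotheses are discharged by
`exists_oddKernel_gramCoeff_envelope`, `exists_oddTable_le_cube`, `tendsto_sum_Ico_oddKernel_mul` (limit images
`c∞(m,j) = Im W_a(1f_j − proj_B 1f_j, w⁻_{m+1})/√2`), `tendsto_sum_Ico_Ico_oddKernel` (band entries), and the series lemmas
of `WeilFormatCDeflatedFarSectorDecay` / `WeilFormatCDeflatedFarEntryLimits`.  DATA hypotheses as in the even file.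

* `oddKernel_nonneg_of_certificate_cinf` — conclusion `0 ≤ Σ_{k,l<K} z_k z_l M⁻(k,l)` for every `K`, `z`
  (the odd hypothesis of `weilPositivityOn_of_sector_kernels_nonneg`).

Standard axioms; no definitions; no RH claim.
-/

set_option autoImplicit false
-- `Summit.RiemannHypothesis.RiemannHypothesis.…` is the layout-mandated namespace (summit = problem name).
set_option linter.dupNamespace false

noncomputable section

open Complex Filter Set MeasureTheory Finset
open scoped Real Topology ComplexConjugate

namespace Summit.RiemannHypothesis.RiemannHypothesis.Theorems.WeilFormatC

open Literature.NumberTheory.LFunctions Literature.NumberTheory.LFunctions.Yoshida1992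

variable {a : ℝ}

/-- **The odd-sector C∞ certificate.**  See the module docstring; the limit objects appear verbatim in the data
hypotheses `hUq` (majorant of the limit coupling) and `hS` (kernel inequality with margin `δ`). -/
theorem oddKernel_nonneg_of_certificate_cinf (ha : 0 < a) {B : ℕ} (hB : 1 ≤ B) {r : ℕ} (f : Fin r → ℝ → ℂ)
    (hf : ∀ j, ContDiff ℝ 3 (f j)) (hfo : ∀ j x, f j (-x) = -f j x) (hfr : ∀ j x, conj (f j x) = f j x)
    (hfa : ∀ j, f j a = 0) (hf1 : ∀ j, deriv (f j) (-a) = deriv (f j) a)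
    -- DATA: far diagonal with floor and far inequality
    (dhat : ℕ → ℝ) {d₀ : ℝ} (hd₀ : 0 < d₀) (hd : ∀ m, B ≤ m → d₀ ≤ dhat m)
    (hfar : ∀ (N : ℕ) (z : ℕ → ℝ),
      ∑ k ∈ Finset.Ico B N, dhat k * z k ^ 2 ≤ ∑ k ∈ Finset.Ico B N, ∑ l ∈ Finset.Ico B N,
        z k * ((gramCoeff a ((k : ℤ) + 1) ((l : ℤ) + 1) - gramCoeff a ((k : ℤ) + 1) (-((l : ℤ) + 1))) / 2) * z l)
    -- DATA: free map, coupling majorant, margin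
    (Λ : (Fin B → ℝ) → (Fin r → ℝ) → Fin r → ℝ) {lam : ℝ} (hlam : 0 ≤ lam)
    (hΛ : ∀ (x : Fin B → ℝ) (β : Fin r → ℝ), ∑ j, |Λ x β j| ≤ lam * (∑ i, |x i| + ∑ j, |β j|))
    (Uq : (Fin B → ℝ) → (Fin r → ℝ) → ℝ)
    (hUq : ∀ (N : ℕ) (x : Fin B → ℝ) (β : Fin r → ℝ),
      ∑ m ∈ Finset.Ico B N,
        (∑ i : Fin B, ((gramCoeff a (((i : ℕ) : ℤ) + 1) ((m : ℤ) + 1) - gramCoeff a (((i : ℕ) : ℤ) + 1) (-((m : ℤ) + 1))) / 2)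
            * x i
          + ∑ j, ((weilWindowSesq a ((Icc (-a) a).indicator (f j) - proj a B ((Icc (-a) a).indicator (f j)))
              (chiOdd a (m + 1))).im / Real.sqrt 2) * β j) ^ 2 / dhat m ≤ Uq x β)
    {δ : ℝ} (hδ : 0 < δ)
    (hS : ∀ (x : Fin B → ℝ) (β : Fin r → ℝ),
      δ * (∑ i, x i ^ 2 + ∑ j, β j ^ 2) ≤
        ((∑ i : Fin B, ∑ i' : Fin B, x i * x i' *
            ((gramCoeff a (((i : ℕ) : ℤ) + 1) (((i' : ℕ) : ℤ) + 1)
              - gramCoeff a (((i : ℕ) : ℤ) + 1) (-((((i' : ℕ) : ℤ)) + 1))) / 2))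
          + 2 * (∑ i : Fin B, ∑ j : Fin r, x i * β j *
            ((weilWindowSesq a ((Icc (-a) a).indicator (f j) - proj a B ((Icc (-a) a).indicator (f j)))
              (chiOdd a ((i : ℕ) + 1))).im / Real.sqrt 2))
          + (∑ j : Fin r, ∑ j' : Fin r, β j * β j' *
            (weilWindowSesq a ((Icc (-a) a).indicator (f j) - proj a B ((Icc (-a) a).indicator (f j)))
              ((Icc (-a) a).indicator (f j') - proj a B ((Icc (-a) a).indicator (f j')))).re))
        - Uq x β
        + ((2 * ∑ j, Λ x β j *
            ((β j - ∑ j', (∑' n : ℕ, if B ≤ n then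
                (2 * (Yoshida1992.fourierCoeff a ((n : ℤ) + 1) ((Icc (-a) a).indicator (f j))).im / Real.sqrt (2 * a)) *
                (2 * (Yoshida1992.fourierCoeff a ((n : ℤ) + 1) ((Icc (-a) a).indicator (f j'))).im / Real.sqrt (2 * a))
                else 0) * β j')
            + (∑ i : Fin B, (∑' m : ℕ, if B ≤ m then
                (2 * (Yoshida1992.fourierCoeff a ((m : ℤ) + 1) ((Icc (-a) a).indicator (f j))).im / Real.sqrt (2 * a)) *
                ((gramCoeff a (((i : ℕ) : ℤ) + 1) ((m : ℤ) + 1) - gramCoeff a (((i : ℕ) : ℤ) + 1) (-((m : ℤ) + 1))) / 2)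
                / dhat m else 0) * x i
              + ∑ j'', (∑' m : ℕ, if B ≤ m then
                (2 * (Yoshida1992.fourierCoeff a ((m : ℤ) + 1) ((Icc (-a) a).indicator (f j))).im / Real.sqrt (2 * a)) *
                ((weilWindowSesq a ((Icc (-a) a).indicator (f j'') - proj a B ((Icc (-a) a).indicator (f j'')))
                  (chiOdd a (m + 1))).im / Real.sqrt 2) / dhat m else 0) * β j'')))
          - ∑ j, ∑ j', Λ x β j * Λ x β j' *
            (∑' m : ℕ, if B ≤ m then
              (2 * (Yoshida1992.fourierCoeff a ((m : ℤ) + 1) ((Icc (-a) a).indicator (f j))).im / Real.sqrt (2 * a)) *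
              (2 * (Yoshida1992.fourierCoeff a ((m : ℤ) + 1) ((Icc (-a) a).indicator (f j'))).im / Real.sqrt (2 * a))
              / dhat m else 0)))
    (K : ℕ) (z : ℕ → ℝ) :
    0 ≤ ∑ k ∈ Finset.range K, ∑ l ∈ Finset.range K, z k * z l *
      ((gramCoeff a ((k : ℤ) + 1) ((l : ℤ) + 1) - gramCoeff a ((k : ℤ) + 1) (-((l : ℤ) + 1))) / 2) := by
  -- the kernel envelope
  obtain ⟨C₀, C₁, hC₀, hC₁, hoff, hdiag⟩ := exists_oddKernel_gramCoeff_envelope ha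
  -- cube decay of the tables, one constant for all profiles
  have hfe₀ : ∀ j, f j (-a) = f j a := fun j ↦ by rw [hfo, hfa, neg_zero]
  choose Kj hKj0 hKj using fun j ↦ exists_oddTable_le_cube ha (hf j) (hfe₀ j) (hf1 j)
  set Kt : ℝ := ∑ j, Kj j with hKt
  have hKt0 : 0 ≤ Kt := Finset.sum_nonneg fun j _ ↦ hKj0 j
  have hV : ∀ (k : ℕ) (j : Fin r), B ≤ k →
      |2 * (Yoshida1992.fourierCoeff a ((k : ℤ) + 1) ((Icc (-a) a).indicator (f j))).im / Real.sqrt (2 * a)|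
        ≤ Kt / (k : ℝ) ^ 3 := by
    intro k j hk
    have h := hKj j k (hB.trans hk)
    have hle : Kj j ≤ Kt := Finset.single_le_sum (fun j _ ↦ hKj0 j) (Finset.mem_univ j)
    exact h.trans (div_le_div_of_nonneg_right hle (by positivity))
  -- kernel rows converge (sector bookkeeping)
  have hc : ∀ (m : ℕ) (j : Fin r), Tendsto (fun P ↦ ∑ k ∈ Finset.Ico B P,
      ((gramCoeff a ((k : ℤ) + 1) ((m : ℤ) + 1) - gramCoeff a ((k : ℤ) + 1) (-((m : ℤ) + 1))) / 2) *
        (2 * (Yoshida1992.fourierCoeff a ((k : ℤ) + 1) ((Icc (-a) a).indicator (f j))).im / Real.sqrt (2 * a))) atTop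
      (𝓝 ((weilWindowSesq a ((Icc (-a) a).indicator (f j) - proj a B ((Icc (-a) a).indicator (f j)))
        (chiOdd a (m + 1))).im / Real.sqrt 2)) :=
    fun m j ↦ tendsto_sum_Ico_oddKernel_mul ha (hf j) (hfo j) (hfr j) (hfa j) (hf1 j) B m
  refine sum_range_mul_mul_nonneg_of_certificate_cinf
    (fun k l : ℕ ↦ ((gramCoeff a ((k : ℤ) + 1) ((l : ℤ) + 1) - gramCoeff a ((k : ℤ) + 1) (-((l : ℤ) + 1))) / 2))
    (fun k l ↦ oddKernel_symm (gramCoeff a) (gramCoeff_comm a) (gramCoeff_neg_neg a) k l) hB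
    (fun (k : ℕ) (j : Fin r) ↦
      2 * (Yoshida1992.fourierCoeff a ((k : ℤ) + 1) ((Icc (-a) a).indicator (f j))).im / Real.sqrt (2 * a))
    dhat hd₀ hC₀ hC₁ zero_le_one hKt0 hd hfar hoff (fun n ↦ by rw [one_mul]; exact hdiag n) hV
    (fun (m : ℕ) (j : Fin r) ↦ (weilWindowSesq a ((Icc (-a) a).indicator (f j) - proj a B ((Icc (-a) a).indicator (f j)))
      (chiOdd a (m + 1))).im / Real.sqrt 2)
    hc _ (fun j j' ↦ tendsto_sum_Ico_Ico_oddKernel ha (hf j) (hfo j) (hfr j) (hfa j) (hf1 j) (hf j') (hfo j') (hfr j')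
      (hfa j') (hf1 j') B) _ _ _ _
    (fun j j' ↦ tendsto_sum_Ico_mul_of_cube hB hKt0 hKt0 (fun n hn ↦ hV n j hn) (fun n hn ↦ hV n j' hn))
    (fun j j' ↦ tendsto_weightedGram hB hd₀ hKt0 hd hV j j')
    (fun j i ↦ tendsto_weightedBlock hB hd₀ hC₀ hKt0 hd hoff hV j i)
    (fun j j'' ↦ tendsto_weightedImage_finite hB hd₀ hC₀ hC₁ zero_le_one hKt0 hd hoff
      (fun n ↦ by rw [one_mul]; exact hdiag n) hV (fun m j _ ↦ hc m j) j j'')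
    Λ hlam hΛ Uq hUq hδ hS K z

end Summit.RiemannHypothesis.RiemannHypothesis.Theorems.WeilFormatC

end
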